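import Mathlib

/-!
# The cyclic class of Theorem K (ii): `a² − 2b² = 2u²` forces `v₂(b) < v₂(a)`
(P2-Zeta8Classes v1 §1 (A); seat p2, pub-hodge-repro0)

`K_D⁺ = ℚ(√2)(√β)` with `β = a + b√2` is cyclic quartic over `ℚ` iff `N(β) = a² − 2b² ∈ 2·ℚ^{×2}`, i.e. (clearing denominators)
`a² − 2b² = 2u²` with `u ≠ 0`. The theorem below shows that then `b = 2^k b'` with `b'` odd and `a = 2^{k+1} a'`: the `√2`-adic
valuation `v_π(β) = min(2 v₂(a), 2 v₂(b) + 1) = 2k + 1` is ODD, so `−β` is not a square in `ℚ₂(√2)`, `(√2)` is not completely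
split in `K_D/K_D⁺`, and EVERY member of the cyclic class attains `cl(√2)` (closed by Theorem K (ii)). Also proved: `b ≠ 0`
(`a² = 2u²` has only the zero solution — the irrationality of `√2` by descent).
-/

namespace HodgeRepro0.CyclicClassZeta8

/-- `a² = 2u²` has only the zero solution in integers (descent) -/
lemma sq_eq_two_sq (n : ℕ) : ∀ a u : ℤ, a.natAbs ≤ n → a ^ 2 = 2 * u ^ 2 → a = 0 ∧ u = 0 := by
  induction n with
  | zero =>
    intro a u ha h
    have ha0 : a = 0 := Int.natAbs_eq_zero.mp (Nat.le_zero.mp ha)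
    subst ha0
    have hu : u ^ 2 = 0 := by nlinarith [sq_nonneg u]
    exact ⟨rfl, pow_eq_zero_iff (by norm_num) |>.mp hu⟩
  | succ n ih =>
    intro a u ha h
    have h2a : (2 : ℤ) ∣ a := by
      have : (2 : ℤ) ∣ a ^ 2 := ⟨u ^ 2, h⟩
      exact Int.prime_two.dvd_of_dvd_pow this
    obtain ⟨a', rfl⟩ := h2a
    have h2u : (2 : ℤ) ∣ u := by
      have : (2 : ℤ) ∣ u ^ 2 := ⟨a' ^ 2, by nlinarith⟩
      exact Int.prime_two.dvd_of_dvd_pow this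
    obtain ⟨u', rfl⟩ := h2u
    have h' : a' ^ 2 = 2 * u' ^ 2 := by nlinarith
    have hsize : a'.natAbs ≤ n := by
      have : (2 * a').natAbs = 2 * a'.natAbs := Int.natAbs_mul 2 a'
      omega
    obtain ⟨ha', hu'⟩ := ih a' u' hsize h'
    subst ha' hu'
    simp

/-- descent on `|b|`: a solution of `a² − 2b² = 2u²` with `u ≠ 0` has `b = 2^k b'`, `b'` odd, and `2^{k+1} ∣ a` -/
lemma descent (n : ℕ) : ∀ a b u : ℤ, b.natAbs ≤ n → a ^ 2 - 2 * b ^ 2 = 2 * u ^ 2 → u ≠ 0 →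
    ∃ k : ℕ, ∃ a' b' : ℤ, a = 2 ^ (k + 1) * a' ∧ b = 2 ^ k * b' ∧ b' % 2 = 1 := by
  induction n with
  | zero =>
    intro a b u hb h hu
    have hb0 : b = 0 := Int.natAbs_eq_zero.mp (Nat.le_zero.mp hb)
    subst hb0
    have h2 : a ^ 2 = 2 * u ^ 2 := by linarith
    exact absurd (sq_eq_two_sq a.natAbs a u le_rfl h2).2 hu
  | succ n ih =>
    intro a b u hb h hu
    -- `a` is even
    have h2a : (2 : ℤ) ∣ a := by
      have : (2 : ℤ) ∣ a ^ 2 := ⟨b ^ 2 + u ^ 2, by linarith⟩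
      exact Int.prime_two.dvd_of_dvd_pow this
    obtain ⟨a', rfl⟩ := h2a
    rcases Int.emod_two_eq_zero_or_one b with hb2 | hb2
    · -- `b` even: divide the equation by 4 and recurse
      obtain ⟨b', rfl⟩ : (2 : ℤ) ∣ b := Int.dvd_of_emod_eq_zero hb2
      have h2u : (2 : ℤ) ∣ u := by
        have : (2 : ℤ) ∣ u ^ 2 := ⟨a' ^ 2 - 2 * b' ^ 2, by nlinarith⟩
        exact Int.prime_two.dvd_of_dvd_pow this
      obtain ⟨u', rfl⟩ := h2u
      have h' : a' ^ 2 - 2 * b' ^ 2 = 2 * u' ^ 2 := by nlinarith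
      have hu' : u' ≠ 0 := by
        rintro rfl
        simp at hu
      have hsize : b'.natAbs ≤ n := by
        have : (2 * b').natAbs = 2 * b'.natAbs := Int.natAbs_mul 2 b'
        omega
      obtain ⟨k, a'', b'', ha, hb', hodd⟩ := ih a' b' u' hsize h' hu'
      refine ⟨k + 1, a'', b'', ?_, ?_, hodd⟩
      · rw [ha]; ring
      · rw [hb']; ring
    · -- `b` odd: `k = 0`
      exact ⟨0, a', b, by ring, by ring, hb2⟩

/-- the cyclic class: `a² − 2b² = 2u²`, `u ≠ 0` ⇒ `b = 2^k b'` with `b'` odd and `2^{k+1} ∣ a`, i.e. `v₂(b) < v₂(a)` -/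
theorem val_b_lt_val_a (a b u : ℤ) (h : a ^ 2 - 2 * b ^ 2 = 2 * u ^ 2) (hu : u ≠ 0) :
    ∃ k : ℕ, ∃ a' b' : ℤ, a = 2 ^ (k + 1) * a' ∧ b = 2 ^ k * b' ∧ b' % 2 = 1 :=
  descent b.natAbs a b u le_rfl h hu

/-- in particular `b ≠ 0` -/
theorem b_ne_zero (a b u : ℤ) (h : a ^ 2 - 2 * b ^ 2 = 2 * u ^ 2) (hu : u ≠ 0) : b ≠ 0 := by
  rintro rfl
  have h2 : a ^ 2 = 2 * u ^ 2 := by linarith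
  exact hu (sq_eq_two_sq a.natAbs a u le_rfl h2).2

end HodgeRepro0.CyclicClassZeta8
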